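import Mathlib
import Literature.MathematicalPhysics.QuantumFieldTheory.Balaban1983to89.B13Step237
import Literature.MathematicalPhysics.QuantumFieldTheory.Balaban1983to89.B13Bound238Assembly
import Literature.MathematicalPhysics.QuantumFieldTheory.Balaban1983to89.B13FamilySum
import Literature.MathematicalPhysics.QuantumFieldTheory.Balaban1983to89.B13MayerDecoupling

/-!
# `Balaban1983to89.B13Lemma3Assembly` — T. Bałaban, *Renormalization group approach to lattice gauge field theories.
II. Cluster expansions*, Commun. Math. Phys. **116** (1988) 1–22 [Balaban1988RG2Cluster]: the RESUMMATION pp. 17–20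
proving Lemma 3 — (2.26) for every term (2.14), summed in the printed order over 𝐃, (Y₀, P), Z₀ and Z′₀, gives (2.38) —
PROVED as ONE chain of bookkeeping over abstract resummation data, every geometric / combinatorial input of the four
pages an explicit hypothesis in the tree's typed shapes

statement-level skeleton of published theorems with citation tags; proofs where landed; nothing here is a claim about
the Yang–Mills mass gap

PDF held: `paper:balaban1988-cmp116-rg-ii-cluster` (journal page = PDF page + 0); pp. 17–20 re-read this session from
the text layer `p0017.txt`–`p0020.txt` of that key and from the cell transcript `pub-balaban/b2b-balaban-b13/
transcript-B13.md` ll. 161–200 (displays (2.26)–(2.38) verbatim from the renders `…-p017-x2.png` … `…-p020-x2.png`).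

CITATION HEADER / WHAT IS REPRODUCED (unit `lit-balaban-r10` gen 5, B13 fold owner; SKELETON rows `B13.Eq2.26`,
`B13.Eq2.35`, `B13.Eq2.37`, `B13.Lem3` of `HOME/lit-balaban-r10/ROWS-B13.md`, HOME = `run/shared/lean/pub/lit-balaban/`;
rows `B13.Eq2.26` / `B13.Eq2.35` so far led `typed-existing (shape)`: the located single steps all had decls —
(2.27)–(2.29) `B13FamilySum`, (2.28) `B13.prod_bound_228`, (2.31) and G7 `B13MayerDecoupling.sum_P_bound_231` /
`card_le_two_mul_card_of_cover`, (2.32) `B13Ineq232*`, (2.33) `B13.case_empty_233` / `B13Ineq232.case_nonempty_233`,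
(2.34) `B13.sum_powerset_le_exp_234`, (2.36) `B13.Ineq236With` / `B13Geometry236*`, the family step of (2.37)
`B13Step237`, the closing paragraph `B13Bound238Assembly` — but the ASSEMBLY of pp. 17–20 into Lemma 3 had none).
P. 17 [PDF 17], verbatim: *"To get a bound for H(Z) we have to perform the resummation of the terms (2.14) over 𝐃, P
and Z₀. We do it in the following order. For a fixed Y₀ we sum over all 𝐃 satisfying (2.2). Next, we sum over Y₀, P
determining a fixed Z₀. Further, for a fixed Z′₀, we sum over all possible Z₀ determining this fixed Z′₀. Finally we
sum over all Z′₀ ⊂ Z. To bound H(Z) we use the estimate (2.26) for terms of these sums, and we bound the sums using the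
factors on the right-hand side of (2.26)."*  (2.26) p. 17: *"|(2.14)| ≦ exp(−(κ₁ − 1)(LM)⁻⁴|Z∖Z′₀|)[Π_{Y∈𝐃}
2E₀ε₁C₁α₄⁻¹M^q exp C₂κ₁ exp(−(1 − 3δ)κd_k(Y))] exp(−½γ₂(ε₁²/g_k²)|P|) · exp O(1)α₅|Z|"*; (2.35) p. 19: *"|Σ_{𝐃,P}(2.14)| ≦
exp(−(κ₁ − 1)(LM)⁻⁴|Z∖Z′₀|)[Π_i ε₂ exp(−(1 − 5δ)κd_k(Z_i))] exp O(1)α₅|Z|"*; (2.37) p. 20: *"|Σ_{𝐃,P,Z₀}(2.14)| ≦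
exp(−(κ₁ − 1)(LM)⁻⁴|Z∖Z′₀|)[Π_i 2(L+2)⁴O(1)ε₂ exp(−(1 − 7δ)½Lκd_{k+1}(Z′_i))] exp O(1)α₅|Z|"*; Lemma 3 (2.38) p. 20:
*"|H(Z)| ≦ C₃ε₁ exp(−(1 − 8δ)½Lκd_{k+1}(Z))"*.  The sentences of pp. 18–20 used by each step are quoted in the docstrings.

THE DATA (abstract; over-counting of the printed index sets is allowed throughout since all weights are ≥ 0).
Scale k: a finite catalogue `S` of 𝐃_k-domains with cube footprints `cubes` and lengths `d` = d_k (the vocabulary of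
`B13FamilySum`: the families 𝐃 with ∪𝐃 = Y₀ are `B13FamilySum.coveringFamilies S cubes Y₀`); for a connected component
Z₀ of the set Z₀ its cubes `cZ` and length `dZ`; bonds `Bond` with the ≤ 2 cubes `touch b` met by a bond and the bonds
`avail Y₀` available to P; `admP` = the P with `cZ ∖ Y₀ ⊆ ∪_{b∈P} touch b` (p. 12 / p. 18, G7).  Scale k + 1: as in
`B13Bound238Assembly` (admissible Z′₀ indexed by `J Z` through the injective complement map `w`, components `I Z j` with
lengths `dI`), plus LM-cube footprints `cubes1` of the 𝐃_{k+1}-domains, the cube sets `cc Z j i` of the components, the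
closure map `cl : 𝐃_k → 𝐃_{k+1}` (p. 19 *"Z′_i the smallest localization domain from 𝐃_{k+1} containing Z̃_i"*) and the
anchor cubes `anchor Z′` (p. 20 *"(L+2)⁴ cubes □′ from π_k … touching a fixed LM-cube in Z′_i"*).  Constants: the record
`B13.Consts` (`eps2` = ε₂ of p. 19, `C3act` = C₃ of p. 20, `R15`), `B13Step237.memberF/bracketF/R18half/R18sharp`,
and reals `a` = γ₂ε₁²/g_k², `M4` (bonds per cube), `c₃₂`, `c₃₂'` (the constants of (2.32) at the two scales), `c₁`, `c₁'`
(volume laws), `K₁` (the anchored sum), `a₅`, `Aabs` (p. 20's O(1)(LM)⁴α₅ and absolute constant), ℓ (transfer factor).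

WHAT IS PROVED (zero `sorry`, no new named fact — D-0026; Mathlib + the modules above only).
* §A (pp. 17–19, ONE component Z₀): `dsum_le_228_229` ((2.28) + (2.29): Σ_𝐃 Π A₀e^{−r₃d} ≤ ε₂e^{−r₄d₀});
  `dsum_empty`; `psum_le_231` (G7 + (2.31): Σ_P e^{−(a/2)|P|} ≤ e^{−(3a/20)|cZ∖Y₀|}); `ysum_term_le_233` ((2.33) for one
  Y₀, both cases); `ysum_le_234` ((2.34) on `cZ`); **`innerSum_le_235`**: the component's partial sum of (2.26)-weights
  `innerSum ≤ ε₂·e^{e^{−a/20}c₁}·exp(−(1 − 5δ)κ d_k(Z₀))` = its factor in (2.35).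
* §B (pp. 19–20, the components with a fixed closure Z′): `compSum` (non-empty sets of components, `= Π(1+g) − 1`);
  `compSum_le_two_mul` (the n-resummation, constant 2); `anchored_sum_le` (the (L+2)⁴-anchored (1.26)-type sum);
  `sum_comp_le` (extraction of e^{−δκd_k} + (2.36)); **`compSum_le_member`**: `≤ 2Eε·exp(−(1 − 6δ)ℓκ d_{k+1}(Z′))`.
* §C (p. 20, one component of Z′₀): `famSum`; **`famSum_le_237`** = `B13Step237.familyStep_consts` on the member weights:
  `≤ (bracketF/α₆)·exp(−(1 − 7δ)ℓκ d_{k+1}(C))` — the bracket of (2.37) in its honest form (cell GAPS C-B13-52).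
* §D **`bound238With_of_226`**: for `S : B13.StepData`, if |H(Z)| is bounded on the space of p. 15 by the (2.26)-weights
  summed in the printed order (hypothesis `hrep`), then `B13.Bound238With S c ℓ` — Lemma 3's (2.38) with a general
  transfer factor ℓ (print ℓ = ½L: `B13.bound238With_half`) — via §A → §B → §C → `B13Bound238Assembly.norm_sum_le_238`.
* §E `lemma3With_of_bound238With`, `lemma3Printed_of_bound238With_half` (the statement rows `B13.Lemma3With`,
  `B13.Lemma3Printed`); `combined_of_227_232` (the combined input of §A follows from (2.27) per component of Y₀,
  `B13FamilySum.Ineq227`, and (2.32) with a generic constant).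

HONEST SCOPE.  (i) Nothing geometric, combinatorial-geometric or analytic is asserted: (2.26) itself (the content of
(2.15)–(2.25)), which index sets occur, (2.27), (2.29), (2.30), (2.32), (2.36), the anchored sum, the counts `M4`,
(L+2)⁴ and the volume laws are INPUTS, typed as hypotheses in the shapes the tree already uses (`B13FamilySum.Ineq126/
Ineq227/Ineq229/VolBound`, `B13.Ineq236With`, `B13.Consts.R15`, `B13Step237.R18half/R18sharp`) or as plain real
inequalities; the tree discharges them for its window / tree-length models elsewhere (`TreeLength*`, `B13Ineq232TreeLength`,
`B13Geometry236Printed`, `TreeLengthCubeSystem`).  (ii) Located slips of print are carried honestly, as in the sibling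
modules: the lower half of (2.30) is used only in its REPAIRED additive form `|X| ≤ c₁(1 + d(X))` (cell GAPS G-B13-07 /
HOME GAPS G-B13-P18-01), so the printed *"can be estimated by 1"* after (2.34) and on p. 20 become factors
`e^{e^{−a/20}c₁}` and `e^{Aabs·c₁′}` absorbed by the O(1) of p. 20 l. 3 and of C₃ (hypothesis `hC3`); (2.32) enters with a
generic constant (print 4, refuted `B13Ineq232Star`; 17 for `treeLen`); the merging at scale k + 1 consumes
`B13Step237.R18sharp` (≤ α₆), not the printed `2(L+2)⁴O(1)ε₂ exp 5κ ≦ 1`.  (iii) Two bookkeeping deviations from the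
letter of print, both only enlarging intermediate sums: the 𝐃-sum is NOT factorized over the components Y_i of Y₀ —
(2.29) is used for the whole Y₀ (`B13FamilySum.Ineq229` is stated and proved for every Y₀) and (2.27) + (2.32) enter in
the combined form of `combined_of_227_232`; the n-component resummation is bounded through `Π(1 + g) − 1 ≤ eˣ − 1 ≤ 2x`
(`Real.exp_bound`) instead of the printed `Σ_{n≥1} xⁿ ≤ 2x` (`B13Step237.nsum_le_two_mul`), same constant 2, the
compatibility constraints among components being dropped (over-count).  (iv) `hrep` is an inequality (triangle
inequality + the printed indexing with over-counting), so a concrete instance only has to inject its true term set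
into the abstract index sets.  (v) ℓ, δ, κ, a, … are real parameters; no numerical value of print is used.
-/

noncomputable section

namespace Literature.MathematicalPhysics.QuantumFieldTheory.Balaban1983to89.B13Lemma3Assembly

open Finset
open Literature.MathematicalPhysics.QuantumFieldTheory.Balaban1983to89

/-! ## §A. (2.26) ⇒ (2.35): the sums over 𝐃, P and Y₀ for ONE connected component Z₀ (pp. 17–19) -/

section LevelA

variable {Cube Dom Bond : Type*} [DecidableEq Cube] [DecidableEq Bond]

/-- The admissible large-field bond sets `P` of a term (2.14) at fixed Z₀-component (cubes `cZ`) and fixed Y₀: p. 12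
*"For a given set P we take the smallest localization domain Z₀ ∈ 𝐃_k containing Y₀ and P. Let us stress that bonds
of P have to be contained in the interior of Z₀"*, read with p. 18 *"The definition of Z₀ yields |P| ≧ ½M⁻⁴|Z₀∖Y₀|,
because one bond in P may connect two cubes in Z₀∖Y₀"* (cell transcript G7: Z₀ = Y₀ ∪ {cubes meeting bonds of P}) —
`P ⊆ avail` (the bonds available to P) whose touched cubes cover `cZ ∖ Y₀`. [cite: Balaban1988RG2Cluster, p.12 (before (2.4)) and p.18 (before (2.31))] -/
def admP (cZ : Finset Cube) (touch : Bond → Finset Cube) (avail : Finset Bond) (Y₀ : Finset Cube) :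
    Finset (Finset Bond) :=
  avail.powerset.filter fun P => cZ \ Y₀ ⊆ P.biUnion touch

/-- The (2.26)-weights of the terms (2.14) belonging to ONE connected component Z₀ (cubes `cZ`) of the set Z₀, summed in
the order of p. 17 *"For a fixed Y₀ we sum over all 𝐃 satisfying (2.2). Next, we sum over Y₀, P determining a fixed
Z₀"*: `Σ_{Y₀ ⊆ cZ} Σ_{P admissible} Σ_{𝐃 : ∪𝐃 = Y₀} [Π_{Y∈𝐃} A₀ e^{−r₃ d_k(Y)}] · e^{−(a/2)|P|}` — (2.26) p. 17 with
A₀ = 2E₀ε₁C₁α₄⁻¹M^q exp C₂κ₁, r₃ = (1 − 3δ)κ, a = γ₂ε₁²/g_k² (the factors e^{−(κ₁−1)(LM)⁻⁴|Z∖Z′₀|} and exp O(1)α₅|Z| of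
(2.26) do not depend on Y₀, P, 𝐃 and are carried outside, §D).  The families 𝐃 are `B13FamilySum.coveringFamilies`.
[cite: Balaban1988RG2Cluster, (2.26) p.17 and p.17 (resummation order)] -/
def innerSum (S : Finset Dom) (cubes : Dom → Finset Cube) (d : Dom → ℝ) (cZ : Finset Cube)
    (touch : Bond → Finset Cube) (avail : Finset Cube → Finset Bond) (A₀ r₃ a : ℝ) : ℝ :=
  ∑ Y₀ ∈ cZ.powerset, ∑ P ∈ admP cZ touch (avail Y₀) Y₀, ∑ D ∈ B13FamilySum.coveringFamilies S cubes Y₀,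
    (∏ Y ∈ D, (A₀ * Real.exp (-(r₃ * d Y)))) * Real.exp (-(a / 2 * (P.card : ℝ)))

omit [DecidableEq Bond] in
/-- A covering family of a NON-EMPTY Y₀ ((2.2) p. 12: *"Y₀ = ∪_{Y∈𝐃} Y"*) is non-empty — the products in (2.28) have at
least one factor. [cite: Balaban1988RG2Cluster, (2.2) p.12] -/
theorem nonempty_of_mem_coveringFamilies {S : Finset Dom} {cubes : Dom → Finset Cube} {Y₀ : Finset Cube}
    (hY₀ : Y₀.Nonempty) {D : Finset Dom} (hD : D ∈ B13FamilySum.coveringFamilies S cubes Y₀) : D.Nonempty := by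
  obtain ⟨-, hU⟩ := B13FamilySum.mem_coveringFamilies.mp hD
  rw [Finset.nonempty_iff_ne_empty]
  rintro rfl
  rw [Finset.biUnion_empty] at hU
  exact hY₀.ne_empty hU.symm

omit [DecidableEq Bond] in
/-- For domains with non-empty footprints the only covering family of Y₀ = ∅ is the empty family (p. 19: *"if Y₀ is
empty, then we have the exponential factor"* — no activity factors). [cite: Balaban1988RG2Cluster, (2.33) p.19] -/
theorem coveringFamilies_empty {S : Finset Dom} {cubes : Dom → Finset Cube} (hne : ∀ Y ∈ S, (cubes Y).Nonempty) :
    B13FamilySum.coveringFamilies S cubes (∅ : Finset Cube) = {∅} := by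
  refine Finset.eq_singleton_iff_unique_mem.mpr ⟨?_, ?_⟩
  · exact B13FamilySum.mem_coveringFamilies.mpr ⟨Finset.empty_subset _, by simp⟩
  · intro D hD
    obtain ⟨hDS, hU⟩ := B13FamilySum.mem_coveringFamilies.mp hD
    rw [Finset.eq_empty_iff_forall_notMem]
    intro Y hY
    obtain ⟨q, hq⟩ := hne Y (hDS hY)
    have : q ∈ D.biUnion cubes := Finset.mem_biUnion.mpr ⟨Y, hY, hq⟩
    rw [hU] at this
    exact Finset.notMem_empty q this

omit [DecidableEq Bond] in
/-- **The sum over 𝐃 with Y₀ fixed, (2.28) + (2.29)** (p. 18 [18]): *"We extract the expression α₆ exp(−δκd_k(Y)) from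
each factor … Assuming 2E₀ε₁C₁α₄⁻¹α₆⁻¹M^q exp C₂κ₁ exp 5κ ≦ 1, we have (2.28) Π_{Y∈𝐃}(… in (2.26)) ≦ Π_{Y∈𝐃} α₆
exp(−δκd_k(Y)) · 2E₀ε₁C₁α₄⁻¹α₆⁻¹M^q exp C₂κ₁ exp(−(1 − 4δ)κd_k(Y₀)). Now we estimate the sum over 𝐃 satisfying (2.2). …
(2.29) Σ_𝐃 Π_{Y∈𝐃} α₆ exp(−δκd_k(Y)) ≦ 1. … The inequalities (2.28), (2.29) yield a bound of the sum over 𝐃."* —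
for a non-empty Y₀, factors `A₀ e^{−r₃ d}` with `A₀ = α₆ε₂`, `r₃ = t + r₄` (print t = δκ, r₄ = (1 − 4δ)κ ≤ κ), the
merging inequality in the form `d₀ + 5 ≤ Σ_{Y∈𝐃}(d_k(Y) + 5)` (`B13.prod_bound_228`; print d₀ = d_k(Y₀) by (2.27) —
below d₀ also absorbs (2.32)), R15 `ε₂ e^{5κ} ≤ 1` and (2.29) at rate t:
`Σ_𝐃 Π_{Y∈𝐃} A₀ e^{−r₃ d_k(Y)} ≤ ε₂ e^{−r₄ d₀}`. [cite: Balaban1988RG2Cluster, (2.28)–(2.29) p.18] -/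
theorem dsum_le_228_229 (S : Finset Dom) (cubes : Dom → Finset Cube) (d : Dom → ℝ) (Y₀ : Finset Cube)
    (hY₀ : Y₀.Nonempty) {A₀ α₆ ε₂ t r₃ r₄ κ d₀ : ℝ} (hA₀ : A₀ = α₆ * ε₂) (hr₃ : r₃ = t + r₄) (hε₂ : 0 ≤ ε₂)
    (hα₆ : 0 ≤ α₆) (hr₄ : 0 ≤ r₄) (hr₄κ : r₄ ≤ κ) (hR15 : ε₂ * Real.exp (5 * κ) ≤ 1)
    (h227 : ∀ D ∈ B13FamilySum.coveringFamilies S cubes Y₀, d₀ + 5 ≤ ∑ Y ∈ D, (d Y + 5))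
    (h229 : ∑ D ∈ B13FamilySum.coveringFamilies S cubes Y₀, ∏ Y ∈ D, (α₆ * Real.exp (-(t * d Y))) ≤ 1) :
    ∑ D ∈ B13FamilySum.coveringFamilies S cubes Y₀, ∏ Y ∈ D, (A₀ * Real.exp (-(r₃ * d Y))) ≤
      ε₂ * Real.exp (-(r₄ * d₀)) := by
  have hsplit : ∀ D : Finset Dom, ∏ Y ∈ D, (A₀ * Real.exp (-(r₃ * d Y))) =
      (∏ Y ∈ D, (α₆ * Real.exp (-(t * d Y)))) * ∏ Y ∈ D, (ε₂ * Real.exp (-(r₄ * d Y))) := by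
    intro D
    rw [← Finset.prod_mul_distrib]
    refine Finset.prod_congr rfl fun Y _ => ?_
    have he : Real.exp (-(r₃ * d Y)) = Real.exp (-(t * d Y)) * Real.exp (-(r₄ * d Y)) := by
      rw [← Real.exp_add, hr₃]; ring_nf
    rw [he, hA₀]; ring
  have hB : 0 ≤ ε₂ * Real.exp (-(r₄ * d₀)) := by positivity
  have hper : ∀ D ∈ B13FamilySum.coveringFamilies S cubes Y₀,
      ∏ Y ∈ D, (A₀ * Real.exp (-(r₃ * d Y))) ≤
        (∏ Y ∈ D, (α₆ * Real.exp (-(t * d Y)))) * (ε₂ * Real.exp (-(r₄ * d₀))) := by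
    intro D hD
    rw [hsplit D]
    exact mul_le_mul_of_nonneg_left
      (B13.prod_bound_228 D (nonempty_of_mem_coveringFamilies hY₀ hD) d ε₂ r₄ κ d₀ hε₂ hr₄ hr₄κ hR15 (h227 D hD))
      (Finset.prod_nonneg fun Y _ => by positivity)
  calc ∑ D ∈ B13FamilySum.coveringFamilies S cubes Y₀, ∏ Y ∈ D, (A₀ * Real.exp (-(r₃ * d Y)))
      ≤ ∑ D ∈ B13FamilySum.coveringFamilies S cubes Y₀,
          (∏ Y ∈ D, (α₆ * Real.exp (-(t * d Y)))) * (ε₂ * Real.exp (-(r₄ * d₀))) := Finset.sum_le_sum hper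
    _ = (∑ D ∈ B13FamilySum.coveringFamilies S cubes Y₀, ∏ Y ∈ D, (α₆ * Real.exp (-(t * d Y)))) *
          (ε₂ * Real.exp (-(r₄ * d₀))) := by rw [Finset.sum_mul]
    _ ≤ 1 * (ε₂ * Real.exp (-(r₄ * d₀))) := mul_le_mul_of_nonneg_right h229 hB
    _ = ε₂ * Real.exp (-(r₄ * d₀)) := one_mul _

omit [DecidableEq Bond] in
/-- The sum over 𝐃 for Y₀ = ∅ is the empty product: `Σ_{𝐃 : ∪𝐃 = ∅} Π_{Y∈𝐃} f(Y) = 1` (domains have non-empty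
footprints). [cite: Balaban1988RG2Cluster, (2.33) p.19] -/
theorem dsum_empty (S : Finset Dom) (cubes : Dom → Finset Cube) (hne : ∀ Y ∈ S, (cubes Y).Nonempty)
    (f : Dom → ℝ) : ∑ D ∈ B13FamilySum.coveringFamilies S cubes (∅ : Finset Cube), ∏ Y ∈ D, f Y = 1 := by
  rw [coveringFamilies_empty hne, Finset.sum_singleton, Finset.prod_empty]

/-- **The sum over P with Y₀ fixed, (2.31)** (p. 18 [18]), verbatim: *"Now we consider the sum over Y₀, P, with fixed
Z₀. It is controlled by the exponential factor with |P| in (2.26). The definition of Z₀ yields |P| ≧ ½M⁻⁴|Z₀∖Y₀|, because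
one bond in P may connect two cubes in Z₀∖Y₀. We decompose the exponential factor into a product of five equal factors.
Four of them are bounded using the above inequality, the fifth is used to bound the sum over P, with a fixed Y₀. We have
(2.31) Σ_P exp(−(1/20)γ₂(ε₁²/g_k²)M⁻⁴|Z₀∖Y₀|) exp(−(1/10)γ₂(ε₁²/g_k²)|P|) ≦ … ≦ 1"* — with N′ = |cZ ∖ Y₀|, every
bond touching ≤ 2 cubes (`B13MayerDecoupling.card_le_two_mul_card_of_cover`), at most `M4·N′` available bonds and the
printed smallness `M4 e^{−a/10} ≤ a/20` (`B13MayerDecoupling.sum_P_bound_231`, `bound_231_le_one`):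
`Σ_{P admissible} e^{−(a/2)|P|} ≤ e^{−(3a/20)N′}` — three of the four fifths `e^{−(a/20)N′}` survive for (2.33) (two)
and (2.34) (one). [cite: Balaban1988RG2Cluster, (2.31) p.18] -/
theorem psum_le_231 (cZ : Finset Cube) (touch : Bond → Finset Cube) (avail : Finset Bond) (Y₀ : Finset Cube)
    {a M4 : ℝ} (ha : 0 ≤ a) (htouch : ∀ b, (touch b).card ≤ 2)
    (havail : (avail.card : ℝ) ≤ M4 * ((cZ \ Y₀).card : ℝ)) (h231 : M4 * Real.exp (-(a / 10)) ≤ a / 20) :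
    ∑ P ∈ admP cZ touch avail Y₀, Real.exp (-(a / 2 * (P.card : ℝ))) ≤
      Real.exp (-(3 * a / 20 * ((cZ \ Y₀).card : ℝ))) := by
  set N' : ℝ := ((cZ \ Y₀).card : ℝ) with hN'def
  have hN' : 0 ≤ N' := Nat.cast_nonneg _
  have hG7 : ∀ P ∈ admP cZ touch avail Y₀, N' ≤ 2 * (P.card : ℝ) := by
    intro P hP
    have hcov := (Finset.mem_filter.mp hP).2
    have h := B13MayerDecoupling.card_le_two_mul_card_of_cover (cZ \ Y₀) P touch (fun b _ => htouch b) hcov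
    rw [hN'def]
    exact_mod_cast h
  have hterm : ∀ P ∈ admP cZ touch avail Y₀, Real.exp (-(a / 2 * (P.card : ℝ))) ≤
      Real.exp (-(3 * a / 20 * N')) * (Real.exp (-(a / 20 * N')) * Real.exp (-(a / 10 * (P.card : ℝ)))) := by
    intro P hP
    rw [← Real.exp_add, ← Real.exp_add]
    apply Real.exp_le_exp.mpr
    have h1 : a * N' ≤ a * (2 * (P.card : ℝ)) := mul_le_mul_of_nonneg_left (hG7 P hP) ha
    nlinarith
  have hnn : ∀ P ∈ avail.powerset, 0 ≤
      Real.exp (-(3 * a / 20 * N')) * (Real.exp (-(a / 20 * N')) * Real.exp (-(a / 10 * (P.card : ℝ)))) :=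
    fun P _ => by positivity
  calc ∑ P ∈ admP cZ touch avail Y₀, Real.exp (-(a / 2 * (P.card : ℝ)))
      ≤ ∑ P ∈ admP cZ touch avail Y₀,
          Real.exp (-(3 * a / 20 * N')) * (Real.exp (-(a / 20 * N')) * Real.exp (-(a / 10 * (P.card : ℝ)))) :=
        Finset.sum_le_sum hterm
    _ ≤ ∑ P ∈ avail.powerset,
          Real.exp (-(3 * a / 20 * N')) * (Real.exp (-(a / 20 * N')) * Real.exp (-(a / 10 * (P.card : ℝ)))) :=
        Finset.sum_le_sum_of_subset_of_nonneg (Finset.filter_subset _ _) fun P hP _ => hnn P hP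
    _ = Real.exp (-(3 * a / 20 * N')) *
          ∑ P ∈ avail.powerset, Real.exp (-(a / 20 * N')) * Real.exp (-(a / 10 * (P.card : ℝ))) := by
        rw [← Finset.mul_sum]
    _ ≤ Real.exp (-(3 * a / 20 * N')) * Real.exp (-(N' * (a / 20 - M4 * Real.exp (-(a / 10))))) :=
        mul_le_mul_of_nonneg_left (B13MayerDecoupling.sum_P_bound_231 avail a N' M4 havail) (Real.exp_nonneg _)
    _ ≤ Real.exp (-(3 * a / 20 * N')) * 1 :=
        mul_le_mul_of_nonneg_left (B13MayerDecoupling.bound_231_le_one a N' M4 hN' h231) (Real.exp_nonneg _)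
    _ = Real.exp (-(3 * a / 20 * N')) := mul_one _

/-- The 𝐃- and P-sums are independent: `Σ_P Σ_𝐃 w(𝐃)·v(P) = (Σ_𝐃 w(𝐃))·(Σ_P v(P))` (p. 17: *"For a fixed Y₀ we sum
over all 𝐃 … Next, we sum over Y₀, P"*); private plumbing. [folklore] -/
private theorem sum_sum_mul_eq {ι κ' : Type*} (A : Finset ι) (B : Finset κ') (f : κ' → ℝ) (g : ι → ℝ) :
    (∑ P ∈ A, ∑ D ∈ B, f D * g P) = (∑ D ∈ B, f D) * ∑ P ∈ A, g P := by
  rw [Finset.sum_mul_sum, Finset.sum_comm]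

/-- **(2.33) for one Y₀ ⊆ Z₀** (pp. 18–19 [18–19]), verbatim: *"In general the set Z₀ is a union of connected
components. Let us denote one of the components by Z₀. It contains Y₀ = ∪_i Y_i. By a simple geometric argument we have
(2.32) … Assuming (1/20)γ₂ε₁²/g_k² ≧ (1/20)γ₂ε₁²/γ² ≧ 4κ, and denoting ε₂ = 2E₀ε₁C₁α₄⁻¹α₆⁻¹M^q exp C₂κ₁, we obtain (2.33)
[Π_i ε₂ exp(−(1 − 4δ)κd_k(Y_i))] exp(−(1/10)γ₂(ε₁²/g_k²)M⁻⁴|Z₀∖Y₀|) ≦ max{ε₂, exp(−(1/20)γ₂ε₁²/γ²)} exp(−(1 − 4δ)κd_k(Z₀)).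
We have used the assumption ε₂ ≦ 1, and the fact that if Y₀ is empty, then we have the exponential factor. For simplicity
let us assume that exp(−(1/20)γ₂ε₁²/γ²) ≦ ε₂."* — HERE for the full partial sum at fixed Y₀: with N′ = |cZ∖Y₀|,
(2.27) for the components of Y₀ together with (2.32) in the COMBINED form `d_k(Z₀) + 5 ≤ Σ_{Y∈𝐃}(d_k(Y) + 5) + c₃₂N′`
(any constant c₃₂: print 4 — refuted, `B13Ineq232Star`; 17 for `treeLen`, `B13Ineq232TreeLength`), R15, R16 as
`c₃₂(1 − 4δ)κ ≤ a/20` and `4κ ≤ a/20`, R17 `e^{−a/20} ≤ ε₂`, the upper half of (2.30) `d_k(Z₀) + 1 ≤ |cZ|` (Y₀ = ∅ case,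
`B13.case_empty_233`) and the (2.31) inputs:
`(Σ_𝐃 Π A₀e^{−(1−3δ)κd}) · (Σ_P e^{−(a/2)|P|}) ≤ ε₂ e^{−(1−4δ)κ d_k(Z₀)} e^{−(a/20)N′}`. [cite: Balaban1988RG2Cluster, (2.32)–(2.33) pp.18–19] -/
theorem ysum_term_le_233 (S : Finset Dom) (cubes : Dom → Finset Cube) (d : Dom → ℝ) (cZ : Finset Cube) (dZ : ℝ)
    (touch : Bond → Finset Cube) (avail : Finset Bond) (Y₀ : Finset Cube) (hY₀ : Y₀ ⊆ cZ)
    {A₀ α₆ ε₂ δ κ a M4 c₃₂ : ℝ} (hA₀ : A₀ = α₆ * ε₂)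
    (hne : ∀ Y ∈ S, (cubes Y).Nonempty) (hα₆ : 0 ≤ α₆) (hε₀ : 0 ≤ ε₂) (hδ : 0 ≤ δ)
    (hδ4 : 0 ≤ 1 - 4 * δ) (hκ : 0 ≤ κ) (ha : 0 ≤ a) (hdZ : 0 ≤ dZ)
    (hR15 : ε₂ * Real.exp (5 * κ) ≤ 1) (hR16 : c₃₂ * ((1 - 4 * δ) * κ) ≤ a / 20) (hR16' : 4 * κ ≤ a / 20)
    (hR17 : Real.exp (-(a / 20)) ≤ ε₂) (h231 : M4 * Real.exp (-(a / 10)) ≤ a / 20)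
    (htouch : ∀ b, (touch b).card ≤ 2) (havail : (avail.card : ℝ) ≤ M4 * ((cZ \ Y₀).card : ℝ))
    (h229 : ∑ D ∈ B13FamilySum.coveringFamilies S cubes Y₀, ∏ Y ∈ D, (α₆ * Real.exp (-(δ * κ * d Y))) ≤ 1)
    (h2732 : ∀ D ∈ B13FamilySum.coveringFamilies S cubes Y₀, D.Nonempty →
      dZ + 5 ≤ ∑ Y ∈ D, (d Y + 5) + c₃₂ * ((cZ \ Y₀).card : ℝ))
    (hN1 : (1 : ℝ) ≤ (cZ.card : ℝ)) (h230 : dZ + 1 ≤ (cZ.card : ℝ)) :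
    (∑ D ∈ B13FamilySum.coveringFamilies S cubes Y₀, ∏ Y ∈ D, (A₀ * Real.exp (-((1 - 3 * δ) * κ * d Y)))) *
        (∑ P ∈ admP cZ touch avail Y₀, Real.exp (-(a / 2 * (P.card : ℝ)))) ≤
      ε₂ * Real.exp (-((1 - 4 * δ) * κ * dZ)) * Real.exp (-(a / 20 * ((cZ \ Y₀).card : ℝ))) := by
  set N' : ℝ := ((cZ \ Y₀).card : ℝ) with hN'def
  have hN' : 0 ≤ N' := Nat.cast_nonneg _
  have hP := psum_le_231 cZ touch avail Y₀ ha htouch havail h231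
  have hPnn : 0 ≤ ∑ P ∈ admP cZ touch avail Y₀, Real.exp (-(a / 2 * (P.card : ℝ))) :=
    Finset.sum_nonneg fun P _ => (Real.exp_pos _).le
  have h3split : Real.exp (-(3 * a / 20 * N')) = Real.exp (-(a / 10 * N')) * Real.exp (-(a / 20 * N')) := by
    rw [← Real.exp_add]; ring_nf
  rcases Y₀.eq_empty_or_nonempty with rfl | hY₀ne
  · -- Y₀ = ∅: no activity factor; the exponential factor alone ((2.33), second member of the max) and R17
    have hD1 := dsum_empty S cubes hne (fun Y => A₀ * Real.exp (-((1 - 3 * δ) * κ * d Y)))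
    rw [hD1, one_mul]
    have hNN : N' = (cZ.card : ℝ) := by rw [hN'def, Finset.sdiff_empty]
    have hce := B13.case_empty_233 a κ δ dZ (cZ.card : ℝ) hN1 h230 hκ hδ hdZ hR16'
    calc ∑ P ∈ admP cZ touch avail ∅, Real.exp (-(a / 2 * (P.card : ℝ)))
        ≤ Real.exp (-(3 * a / 20 * N')) := hP
      _ = Real.exp (-(a / 10 * (cZ.card : ℝ))) * Real.exp (-(a / 20 * N')) := by rw [h3split, hNN]
      _ ≤ Real.exp (-(a / 20)) * Real.exp (-((1 - 4 * δ) * κ * dZ)) * Real.exp (-(a / 20 * N')) :=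
          mul_le_mul_of_nonneg_right hce (Real.exp_nonneg _)
      _ ≤ ε₂ * Real.exp (-((1 - 4 * δ) * κ * dZ)) * Real.exp (-(a / 20 * N')) := by
          gcongr
  · -- Y₀ ≠ ∅: (2.28) + (2.29) with d₀ = d_k(Z₀) − c₃₂N′ ((2.27) + (2.32)), then absorb the price by one fifth
    have h227 : ∀ D ∈ B13FamilySum.coveringFamilies S cubes Y₀, (dZ - c₃₂ * N') + 5 ≤ ∑ Y ∈ D, (d Y + 5) := by
      intro D hD
      have := h2732 D hD (nonempty_of_mem_coveringFamilies hY₀ne hD)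
      linarith
    have hD := dsum_le_228_229 S cubes d Y₀ hY₀ne (A₀ := A₀) (t := δ * κ) (r₃ := (1 - 3 * δ) * κ)
      (r₄ := (1 - 4 * δ) * κ) hA₀ (by ring) hε₀ hα₆ (by positivity) (by nlinarith) hR15 h227 h229
    have hDnn : 0 ≤ ε₂ * Real.exp (-((1 - 4 * δ) * κ * (dZ - c₃₂ * N'))) := by positivity
    calc (∑ D ∈ B13FamilySum.coveringFamilies S cubes Y₀, ∏ Y ∈ D, (A₀ * Real.exp (-((1 - 3 * δ) * κ * d Y)))) *
          (∑ P ∈ admP cZ touch avail Y₀, Real.exp (-(a / 2 * (P.card : ℝ))))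
        ≤ (ε₂ * Real.exp (-((1 - 4 * δ) * κ * (dZ - c₃₂ * N')))) * Real.exp (-(3 * a / 20 * N')) :=
          mul_le_mul hD hP hPnn hDnn
      _ = ε₂ * (Real.exp (-((1 - 4 * δ) * κ * (dZ - c₃₂ * N'))) * Real.exp (-(3 * a / 20 * N'))) := by ring
      _ ≤ ε₂ * (Real.exp (-((1 - 4 * δ) * κ * dZ)) * Real.exp (-(a / 20 * N'))) := by
          refine mul_le_mul_of_nonneg_left ?_ hε₀
          rw [← Real.exp_add, ← Real.exp_add]
          apply Real.exp_le_exp.mpr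
          have h1 : c₃₂ * ((1 - 4 * δ) * κ) * N' ≤ a / 20 * N' := mul_le_mul_of_nonneg_right hR16 hN'
          have h2 : 0 ≤ a * N' := mul_nonneg ha hN'
          nlinarith
      _ = ε₂ * Real.exp (-((1 - 4 * δ) * κ * dZ)) * Real.exp (-(a / 20 * N')) := by ring

omit [DecidableEq Bond] in
/-- **(2.34)** (p. 19 [19]) on the cubes of Z₀: `Σ_{Y₀ ⊆ cZ} e^{−(a/20)|cZ∖Y₀|} = (1 + e^{−a/20})^{|cZ|} ≤
exp(e^{−a/20}|cZ|)` — verbatim *"Finally, we have the sum over Y₀ ⊂ Z₀, or over Z₀∖Y₀. The remaining factor is used to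
bound this sum (2.34) Σ_{Z₀∖Y₀} exp(−(1/20)γ₂(ε₁²/g_k²)M⁻⁴|Z₀∖Y₀|) ≦ exp(exp(−(1/20)γ₂ε₁²/γ²)M⁻⁴|Z₀|)"*
(`B13.sum_powerset_le_exp_234` is the same count over subsets). [cite: Balaban1988RG2Cluster, (2.34) p.19] -/
theorem ysum_le_234 (cZ : Finset Cube) (a : ℝ) :
    ∑ Y₀ ∈ cZ.powerset, Real.exp (-(a / 20 * ((cZ \ Y₀).card : ℝ))) ≤
      Real.exp (Real.exp (-(a / 20)) * (cZ.card : ℝ)) := by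
  set b : ℝ := Real.exp (-(a / 20)) with hb
  have hb0 : 0 ≤ b := (Real.exp_pos _).le
  have hterm : ∀ Y₀ ∈ cZ.powerset, Real.exp (-(a / 20 * ((cZ \ Y₀).card : ℝ))) =
      (1 : ℝ) ^ Y₀.card * b ^ (cZ.card - Y₀.card) := by
    intro Y₀ hY₀
    rw [one_pow, one_mul, ← Finset.card_sdiff_of_subset (Finset.mem_powerset.mp hY₀), hb, ← Real.exp_nat_mul]
    ring_nf
  rw [Finset.sum_congr rfl hterm, Finset.sum_pow_mul_eq_add_pow]
  have h1 : 1 + b ≤ Real.exp b := by linarith [Real.add_one_le_exp b]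
  calc (1 + b) ^ cZ.card ≤ Real.exp b ^ cZ.card := pow_le_pow_left₀ (by positivity) h1 _
    _ = Real.exp (b * (cZ.card : ℝ)) := by rw [← Real.exp_nat_mul]; ring_nf

/-- **(2.26) ⇒ (2.35) for one connected component Z₀** (pp. 17–19; (2.35) p. 19 [19], verbatim: *"The exponential
on the right-hand side [of (2.34)] multiplied by exp(−δκd_k(Z₀)) can be estimated by 1. Let us write the inequality we
have obtained for the partially resummed terms (2.14). The set Z₀ is a union of connected components, Z₀ = ∪_i Z_i, and
we have (2.35) |Σ_{𝐃,P}(2.14)| ≦ exp(−(κ₁ − 1)(LM)⁻⁴|Z∖Z′₀|)[Π_i ε₂ exp(−(1 − 5δ)κd_k(Z_i))] exp O(1)α₅|Z|"*).  PROVED as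
bookkeeping for the component's own factor: `innerSum ≤ ε₂ · e^{e^{−a/20}c₁} · exp(−(1 − 5δ)κ d_k(Z₀))`, GIVEN (in
the tree's shapes, for the component `cZ` with d_k = `dZ`): domains with non-empty footprints; (2.29) at rate δκ
(`B13FamilySum.Ineq229`-summands); (2.27) for the components of Y₀ with (2.32) in the combined form `dZ + 5 ≤
Σ_{Y∈𝐃}(d_k(Y) + 5) + c₃₂|cZ∖Y₀|`; G7 (bonds touch ≤ 2 cubes) and `|avail| ≤ M4·|cZ∖Y₀|`; the upper half of (2.30)
`dZ + 1 ≤ |cZ|`; the volume law in its REPAIRED additive form `|cZ| ≤ c₁(1 + dZ)` (cell GAPS G-B13-07: the printed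
multiplicative lower half of (2.30) fails at d_k = 0, `B13Ineq230Printed.not_ineq230Lower_sys`) with
`e^{−a/20}c₁ ≤ δκ`; and the smallness clauses R15 `ε₂e^{5κ} ≤ 1`, R16 (`c₃₂(1−4δ)κ ≤ a/20`, `4κ ≤ a/20`), R17
`e^{−a/20} ≤ ε₂`, (2.31) `M4e^{−a/10} ≤ a/20`, `ε₂ ≤ 1`… (`0 ≤ δ ≤ ¼`, `κ, a ≥ 0`).  The printed *"can be estimated by
1"* becomes the honest factor `e^{e^{−a/20}c₁}` (≤ e under R17-size smallness), absorbed downstream by the O(1) of p. 20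
l. 3 — the same located slip as G-B13-P18-01 / P21-01. [cite: Balaban1988RG2Cluster, (2.35) p.19] -/
theorem innerSum_le_235 (S : Finset Dom) (cubes : Dom → Finset Cube) (d : Dom → ℝ) (cZ : Finset Cube) (dZ : ℝ)
    (touch : Bond → Finset Cube) (avail : Finset Cube → Finset Bond)
    {A₀ α₆ ε₂ δ κ a M4 c₃₂ c₁ : ℝ} (hA₀ : A₀ = α₆ * ε₂)
    (hne : ∀ Y ∈ S, (cubes Y).Nonempty) (hα₆ : 0 ≤ α₆) (hε₀ : 0 ≤ ε₂) (hδ : 0 ≤ δ)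
    (hδ4 : 0 ≤ 1 - 4 * δ) (hκ : 0 ≤ κ) (ha : 0 ≤ a) (hdZ : 0 ≤ dZ)
    (hR15 : ε₂ * Real.exp (5 * κ) ≤ 1) (hR16 : c₃₂ * ((1 - 4 * δ) * κ) ≤ a / 20) (hR16' : 4 * κ ≤ a / 20)
    (hR17 : Real.exp (-(a / 20)) ≤ ε₂) (h231 : M4 * Real.exp (-(a / 10)) ≤ a / 20)
    (htouch : ∀ b, (touch b).card ≤ 2)
    (havail : ∀ Y₀, Y₀ ⊆ cZ → ((avail Y₀).card : ℝ) ≤ M4 * ((cZ \ Y₀).card : ℝ))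
    (h229 : ∀ Y₀, Y₀ ⊆ cZ →
      ∑ D ∈ B13FamilySum.coveringFamilies S cubes Y₀, ∏ Y ∈ D, (α₆ * Real.exp (-(δ * κ * d Y))) ≤ 1)
    (h2732 : ∀ Y₀, Y₀ ⊆ cZ → ∀ D ∈ B13FamilySum.coveringFamilies S cubes Y₀, D.Nonempty →
      dZ + 5 ≤ ∑ Y ∈ D, (d Y + 5) + c₃₂ * ((cZ \ Y₀).card : ℝ))
    (hN1 : (1 : ℝ) ≤ (cZ.card : ℝ)) (h230 : dZ + 1 ≤ (cZ.card : ℝ)) (hvol : (cZ.card : ℝ) ≤ c₁ * (1 + dZ))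
    (habs : Real.exp (-(a / 20)) * c₁ ≤ δ * κ) :
    innerSum S cubes d cZ touch avail A₀ ((1 - 3 * δ) * κ) a ≤
      ε₂ * Real.exp (Real.exp (-(a / 20)) * c₁) * Real.exp (-((1 - 5 * δ) * κ * dZ)) := by
  set b : ℝ := Real.exp (-(a / 20)) with hb
  have hb0 : 0 ≤ b := (Real.exp_pos _).le
  -- per Y₀
  have hY : ∀ Y₀ ∈ cZ.powerset,
      (∑ P ∈ admP cZ touch (avail Y₀) Y₀, ∑ D ∈ B13FamilySum.coveringFamilies S cubes Y₀,
        (∏ Y ∈ D, (A₀ * Real.exp (-((1 - 3 * δ) * κ * d Y)))) * Real.exp (-(a / 2 * (P.card : ℝ)))) ≤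
      ε₂ * Real.exp (-((1 - 4 * δ) * κ * dZ)) * Real.exp (-(a / 20 * ((cZ \ Y₀).card : ℝ))) := by
    intro Y₀ hY₀
    have hY₀' := Finset.mem_powerset.mp hY₀
    rw [sum_sum_mul_eq]
    exact ysum_term_le_233 S cubes d cZ dZ touch (avail Y₀) Y₀ hY₀' hA₀ hne hα₆ hε₀ hδ hδ4 hκ ha hdZ hR15 hR16
      hR16' hR17 h231 htouch (havail Y₀ hY₀') (h229 Y₀ hY₀') (h2732 Y₀ hY₀') hN1 h230
  have h234 := ysum_le_234 cZ a
  have hpref : 0 ≤ ε₂ * Real.exp (-((1 - 4 * δ) * κ * dZ)) := by positivity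
  -- the volume law (repaired, additive) and the absorption into the rate
  have hexp : Real.exp (b * (cZ.card : ℝ)) ≤ Real.exp (b * c₁) * Real.exp (δ * κ * dZ) := by
    rw [← Real.exp_add]
    apply Real.exp_le_exp.mpr
    have h1 : b * (cZ.card : ℝ) ≤ b * (c₁ * (1 + dZ)) := mul_le_mul_of_nonneg_left hvol hb0
    have h2 : b * c₁ * dZ ≤ δ * κ * dZ := mul_le_mul_of_nonneg_right habs hdZ
    nlinarith
  calc innerSum S cubes d cZ touch avail A₀ ((1 - 3 * δ) * κ) a
      ≤ ∑ Y₀ ∈ cZ.powerset, ε₂ * Real.exp (-((1 - 4 * δ) * κ * dZ)) * Real.exp (-(a / 20 * ((cZ \ Y₀).card : ℝ))) :=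
        Finset.sum_le_sum hY
    _ = ε₂ * Real.exp (-((1 - 4 * δ) * κ * dZ)) * ∑ Y₀ ∈ cZ.powerset, Real.exp (-(a / 20 * ((cZ \ Y₀).card : ℝ))) := by
        rw [Finset.mul_sum]
    _ ≤ ε₂ * Real.exp (-((1 - 4 * δ) * κ * dZ)) * Real.exp (b * (cZ.card : ℝ)) :=
        mul_le_mul_of_nonneg_left h234 hpref
    _ ≤ ε₂ * Real.exp (-((1 - 4 * δ) * κ * dZ)) * (Real.exp (b * c₁) * Real.exp (δ * κ * dZ)) :=
        mul_le_mul_of_nonneg_left hexp hpref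
    _ = ε₂ * Real.exp (b * c₁) * (Real.exp (-((1 - 4 * δ) * κ * dZ)) * Real.exp (δ * κ * dZ)) := by ring
    _ = ε₂ * Real.exp (b * c₁) * Real.exp (-((1 - 5 * δ) * κ * dZ)) := by
        rw [← Real.exp_add]; ring_nf

omit [DecidableEq Bond] in
/-- The right-hand side of (2.26) p. 17 is a product of non-negative factors, hence `innerSum ≥ 0` (for A₀ ≥ 0).
[cite: Balaban1988RG2Cluster, (2.26) p.17] -/
theorem innerSum_nonneg (S : Finset Dom) (cubes : Dom → Finset Cube) (d : Dom → ℝ) (cZ : Finset Cube)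
    (touch : Bond → Finset Cube) (avail : Finset Cube → Finset Bond) {A₀ r₃ a : ℝ} (hA₀ : 0 ≤ A₀) :
    0 ≤ innerSum S cubes d cZ touch avail A₀ r₃ a :=
  Finset.sum_nonneg fun _ _ => Finset.sum_nonneg fun _ _ => Finset.sum_nonneg fun _ _ =>
    mul_nonneg (Finset.prod_nonneg fun _ _ => by positivity) (Real.exp_nonneg _)

end LevelA

/-! ## §B. (2.35) ⇒ (2.37), first half: the sum over the components Z_i of Z₀ with a fixed closure Z′ (pp. 19–20) -/

section LevelB

variable {KD : Type*} [DecidableEq KD]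

/-- The n-component resummation index at a fixed 𝐃_{k+1}-domain Z′ (p. 19 [19]: *"For each Z′_i we sum over all
possible components of Z₀ determining this Z′_i. … the sum over the components can be decomposed into a sum over one
component, plus a sum over two components, and so on"*): the non-empty sets `A` of components drawn from the catalogue
`K` (= the 𝐃_k-domains whose closure is Z′), each component `Z` weighted by `g Z` (its partial sum (2.35));
`compSum K g = Σ_{∅ ≠ A ⊆ K} Π_{Z∈A} g Z` (the compatibility of the components is dropped — an over-count).
[cite: Balaban1988RG2Cluster, p.19 (after (2.36))] -/
def compSum (K : Finset KD) (g : KD → ℝ) : ℝ := ∑ A ∈ K.powerset.erase ∅, ∏ Z ∈ A, g Z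

/-- `compSum K g = Π_{Z∈K}(1 + g Z) − 1`; private plumbing. [folklore] -/
private theorem compSum_eq (K : Finset KD) (g : KD → ℝ) : compSum K g = ∏ Z ∈ K, (1 + g Z) - 1 := by
  unfold compSum
  rw [Finset.prod_one_add K, ← Finset.add_sum_erase _ _ (Finset.empty_mem_powerset K), Finset.prod_empty]
  ring

/-- The component resummation of p. 19 has non-negative terms for non-negative component weights: `compSum ≥ 0`.
[cite: Balaban1988RG2Cluster, p.19 (after (2.36))] -/
theorem compSum_nonneg (K : Finset KD) (g : KD → ℝ) (hg : ∀ Z ∈ K, 0 ≤ g Z) : 0 ≤ compSum K g := by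
  unfold compSum
  refine Finset.sum_nonneg fun A hA => Finset.prod_nonneg fun Z hZ => hg Z ?_
  exact Finset.mem_powerset.mp (Finset.mem_of_mem_erase hA) hZ

/-- P. 20 ll. 1–5 [20]: *"A sum over n components is estimated by a product of n sums, each of them is a sum over
independently changing components. … For n > 1 we leave only one exponential, estimating by 1 the remaining ones with
the same domain Z′_i. The sum over n ≧ 1 is now bounded by 2(L+2)⁴O(1)ε₂, assuming that (L+2)⁴O(1)ε₂ ≦ ½"* — the
n-resummation: with `x = Σ_{Z∈K} g Z ≤ 1` (print: ≤ ½; `B13Step237.nsum_le_two_mul` is the printed Σ_{n≥1} xⁿ ≤ 2x),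
`compSum K g ≤ 2x` (here via `Π(1 + g) − 1 ≤ eˣ − 1 ≤ 2x`, `B13FamilySum.prod_one_add_le_exp_sum` and Mathlib's
`Real.exp_bound` — the same constant 2). [cite: Balaban1988RG2Cluster, p.20 (before (2.37))] -/
theorem compSum_le_two_mul (K : Finset KD) (g : KD → ℝ) (hg : ∀ Z ∈ K, 0 ≤ g Z) (hx : ∑ Z ∈ K, g Z ≤ 1) :
    compSum K g ≤ 2 * ∑ Z ∈ K, g Z := by
  rw [compSum_eq]
  have h1 : ∏ Z ∈ K, (1 + g Z) ≤ Real.exp (∑ Z ∈ K, g Z) := B13FamilySum.prod_one_add_le_exp_sum K g hg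
  have hy0 : 0 ≤ ∑ Z ∈ K, g Z := Finset.sum_nonneg hg
  have habs : |∑ Z ∈ K, g Z| ≤ 1 := by rwa [abs_of_nonneg hy0]
  have hb := Real.exp_bound habs (n := 1) one_pos
  simp only [Finset.sum_range_one, pow_zero, Nat.factorial_zero, Nat.cast_one, div_one, pow_one,
    Nat.factorial_one, Nat.succ_eq_add_one, mul_one] at hb
  rw [abs_of_nonneg hy0] at hb
  have h2 := (abs_le.mp hb).2
  norm_num at h2
  linarith

omit [DecidableEq KD] in
/-- P. 19 l. −3 – p. 20 l. 3 [19–20]: *"The last sum is estimated using (1.28), with κ replaced by δκ, and with an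
additional sum over (L+2)⁴ cubes □′ from π_k, the cubes touching a fixed LM-cube in Z′_i"* — the anchored entropy
input in the shape of (1.26) `B13FamilySum.Ineq126` (cell reading, as in `B13Step237`): if every component `Z ∈ K`
contains one of the anchor cubes, the weights are ≥ 0 on the ambient catalogue `Kall ⊇ K`, and for each anchor cube the
anchored sum over `Kall` is ≤ B, then `Σ_{Z∈K} β Z ≤ |anchor|·B` (print: |anchor| ≤ (L+2)⁴, B = O(1)).
[cite: Balaban1988RG2Cluster, p.19–20 (before (2.37))] -/
theorem anchored_sum_le {Cube : Type*} [DecidableEq Cube] (K Kall : Finset KD) (hK : K ⊆ Kall)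
    (cubesK : KD → Finset Cube) (anchor : Finset Cube) (β : KD → ℝ) (hβ : ∀ Z ∈ Kall, 0 ≤ β Z)
    (hanch : ∀ Z ∈ K, ∃ q ∈ anchor, q ∈ cubesK Z) {B : ℝ}
    (h126 : ∀ q ∈ anchor, ∑ Z ∈ Kall.filter (fun Z => q ∈ cubesK Z), β Z ≤ B) :
    ∑ Z ∈ K, β Z ≤ (anchor.card : ℝ) * B := by
  classical
  set g : KD → Cube → ℝ := fun Z q => if q ∈ cubesK Z then β Z else 0 with hg
  have h1 : ∑ Z ∈ K, β Z ≤ ∑ Z ∈ K, ∑ q ∈ anchor, g Z q := by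
    refine Finset.sum_le_sum fun Z hZ => ?_
    obtain ⟨q₀, hq₀, hq₀Z⟩ := hanch Z hZ
    have hg0 : ∀ q ∈ anchor, 0 ≤ g Z q := fun q _ => by
      simp only [hg]; split_ifs
      · exact hβ Z (hK hZ)
      · exact le_rfl
    calc β Z = g Z q₀ := by simp [hg, hq₀Z]
      _ ≤ ∑ q ∈ anchor, g Z q := Finset.single_le_sum hg0 hq₀
  have h3 : ∀ q ∈ anchor, ∑ Z ∈ K, g Z q ≤ B := by
    intro q hq
    calc ∑ Z ∈ K, g Z q = ∑ Z ∈ K.filter (fun Z => q ∈ cubesK Z), β Z := by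
          rw [Finset.sum_filter]
      _ ≤ ∑ Z ∈ Kall.filter (fun Z => q ∈ cubesK Z), β Z := by
          refine Finset.sum_le_sum_of_subset_of_nonneg ?_ ?_
          · intro Z hZ
            rw [Finset.mem_filter] at hZ ⊢
            exact ⟨hK hZ.1, hZ.2⟩
          · intro Z hZ _
            exact hβ Z (Finset.mem_filter.mp hZ).1
      _ ≤ B := h126 q hq
  calc ∑ Z ∈ K, β Z ≤ ∑ Z ∈ K, ∑ q ∈ anchor, g Z q := h1
    _ = ∑ q ∈ anchor, ∑ Z ∈ K, g Z q := Finset.sum_comm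
    _ ≤ ∑ q ∈ anchor, B := Finset.sum_le_sum h3
    _ = (anchor.card : ℝ) * B := by rw [Finset.sum_const, nsmul_eq_mul]

omit [DecidableEq KD] in
/-- P. 19 [19], verbatim: *"We extract exp(−δκd_k(Z_i)) from each exponential in (2.35), corresponding to one of these
components. The remaining exponential is bounded using the following inequality: (2.36) 2d_k(Z_i) ≧ Ld_{k+1}(Z′_i)"* and
p. 20 l. 2–3: *"This yields a bound similar to (2.35), with ε₂ replaced by (L+2)⁴O(1)ε₂, and (1 − 5δ)κd_k(Z_i) in the
exponentials replaced by (1 − 6δ)½Lκd_{k+1}(Z′_i)"* — for the ONE-component sum: if `g Z ≤ ε·e^{−(t+u)d_k(Z)}` on `K`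
(print ε = ε₂, t = δκ, u = (1 − 6δ)κ), the transfer `ℓ·d_{k+1}(Z′) ≤ d_k(Z)` holds on `K` (`B13.Ineq236With`; print
ℓ = ½L) and the extracted factors sum to `Σ_{Z∈K} e^{−t d_k(Z)} ≤ E` (print E = (L+2)⁴O(1)), then
`Σ_{Z∈K} g Z ≤ E·ε·exp(−u·ℓ·d_{k+1}(Z′))`. [cite: Balaban1988RG2Cluster, (2.36) p.19 and p.20 (before (2.37))] -/
theorem sum_comp_le (K : Finset KD) (g dK : KD → ℝ) {ε t u ℓ dZ' E : ℝ} (hε : 0 ≤ ε) (hu : 0 ≤ u)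
    (hg : ∀ Z ∈ K, g Z ≤ ε * Real.exp (-((t + u) * dK Z))) (h236 : ∀ Z ∈ K, ℓ * dZ' ≤ dK Z)
    (hent : ∑ Z ∈ K, Real.exp (-(t * dK Z)) ≤ E) :
    ∑ Z ∈ K, g Z ≤ E * ε * Real.exp (-(u * ℓ * dZ')) := by
  have hB : 0 ≤ ε * Real.exp (-(u * ℓ * dZ')) := by positivity
  have hper : ∀ Z ∈ K, g Z ≤ Real.exp (-(t * dK Z)) * (ε * Real.exp (-(u * ℓ * dZ'))) := by
    intro Z hZ
    refine le_trans (hg Z hZ) ?_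
    have he : ε * Real.exp (-((t + u) * dK Z)) = Real.exp (-(t * dK Z)) * (ε * Real.exp (-(u * dK Z))) := by
      have : -((t + u) * dK Z) = -(t * dK Z) + -(u * dK Z) := by ring
      rw [this, Real.exp_add]; ring
    rw [he]
    refine mul_le_mul_of_nonneg_left (mul_le_mul_of_nonneg_left (Real.exp_le_exp.mpr ?_) hε) (Real.exp_nonneg _)
    have := mul_le_mul_of_nonneg_left (h236 Z hZ) hu
    linarith
  calc ∑ Z ∈ K, g Z ≤ ∑ Z ∈ K, Real.exp (-(t * dK Z)) * (ε * Real.exp (-(u * ℓ * dZ'))) := Finset.sum_le_sum hper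
    _ = (∑ Z ∈ K, Real.exp (-(t * dK Z))) * (ε * Real.exp (-(u * ℓ * dZ'))) := by rw [Finset.sum_mul]
    _ ≤ E * (ε * Real.exp (-(u * ℓ * dZ'))) := mul_le_mul_of_nonneg_right hent hB
    _ = E * ε * Real.exp (-(u * ℓ * dZ')) := by ring

/-- **The member weight of (2.37)** (p. 20 ll. 1–5 [20]): the whole sum over the components of Z₀ with closure Z′ —
one, two, … components — is at most `2Eε · exp(−u·ℓ·d_{k+1}(Z′))` (print: 2(L+2)⁴O(1)ε₂ exp(−(1 − 6δ)½Lκd_{k+1}(Z′)))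
under the inputs of `sum_comp_le`, non-negative weights and the smallness `E·ε ≤ ½` (print: *"assuming that
(L+2)⁴O(1)ε₂ ≦ ½"*, `B13Step237.R18half`), for `u, ℓ, d_{k+1}(Z′) ≥ 0`. [cite: Balaban1988RG2Cluster, p.20 (before (2.37))] -/
theorem compSum_le_member (K : Finset KD) (g dK : KD → ℝ) {ε t u ℓ dZ' E : ℝ} (hε : 0 ≤ ε) (hu : 0 ≤ u)
    (hℓ : 0 ≤ ℓ) (hdZ' : 0 ≤ dZ') (hg0 : ∀ Z ∈ K, 0 ≤ g Z)
    (hg : ∀ Z ∈ K, g Z ≤ ε * Real.exp (-((t + u) * dK Z))) (h236 : ∀ Z ∈ K, ℓ * dZ' ≤ dK Z)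
    (hent : ∑ Z ∈ K, Real.exp (-(t * dK Z)) ≤ E) (hhalf : E * ε ≤ 1 / 2) :
    compSum K g ≤ 2 * (E * ε) * Real.exp (-(u * ℓ * dZ')) := by
  have hy := sum_comp_le K g dK hε hu hg h236 hent
  have hexp1 : Real.exp (-(u * ℓ * dZ')) ≤ 1 := by
    rw [Real.exp_le_one_iff]
    have : 0 ≤ u * ℓ * dZ' := by positivity
    linarith
  have hE : 0 ≤ E := le_trans (Finset.sum_nonneg fun Z _ => (Real.exp_pos _).le) hent
  have hx1 : ∑ Z ∈ K, g Z ≤ 1 := by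
    have : E * ε * Real.exp (-(u * ℓ * dZ')) ≤ E * ε * 1 := mul_le_mul_of_nonneg_left hexp1 (by positivity)
    linarith
  calc compSum K g ≤ 2 * ∑ Z ∈ K, g Z := compSum_le_two_mul K g hg0 hx1
    _ ≤ 2 * (E * ε * Real.exp (-(u * ℓ * dZ'))) := by linarith
    _ = 2 * (E * ε) * Real.exp (-(u * ℓ * dZ')) := by ring

end LevelB

/-! ## §C. (2.35) ⇒ (2.37), second half: the sum over the families {Z′_l} covering a component of Z′₀ (p. 20) -/

section LevelC

variable {ι : Type*}

/-- The family sum at a fixed connected component C of Z′₀ (p. 20 [20]: *"Finally, the sum over all families of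
different localization domains Z′_i from 𝐃_{k+1}, satisfying the condition ∪_i Z′_i = Z′₀, is estimated using
(2.29)"*): `famSum Fam G = Σ_{𝒟 ∈ Fam} Π_{Z′∈𝒟} G Z′` with `G Z′` the member weight (the component sum `compSum` at Z′).
[cite: Balaban1988RG2Cluster, p.20 (before (2.37))] -/
def famSum (Fam : Finset (Finset ι)) (G : ι → ℝ) : ℝ := ∑ 𝒟 ∈ Fam, ∏ Z' ∈ 𝒟, G Z'

/-- The family sum of p. 20 is monotone in non-negative member weights (used to insert the member bound of §B).
[cite: Balaban1988RG2Cluster, p.20 (before (2.37))] -/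
theorem famSum_mono (Fam : Finset (Finset ι)) {G G' : ι → ℝ} (hG0 : ∀ 𝒟 ∈ Fam, ∀ Z' ∈ 𝒟, 0 ≤ G Z')
    (hle : ∀ 𝒟 ∈ Fam, ∀ Z' ∈ 𝒟, G Z' ≤ G' Z') : famSum Fam G ≤ famSum Fam G' :=
  Finset.sum_le_sum fun 𝒟 h𝒟 => Finset.prod_le_prod (hG0 𝒟 h𝒟) (hle 𝒟 h𝒟)

/-- The family sum of p. 20 is non-negative for non-negative member weights.
[cite: Balaban1988RG2Cluster, p.20 (before (2.37))] -/
theorem famSum_nonneg (Fam : Finset (Finset ι)) {G : ι → ℝ} (hG0 : ∀ 𝒟 ∈ Fam, ∀ Z' ∈ 𝒟, 0 ≤ G Z') :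
    0 ≤ famSum Fam G :=
  Finset.sum_nonneg fun 𝒟 h𝒟 => Finset.prod_nonneg (hG0 𝒟 h𝒟)

/-- **(2.37), the bracket of one component C of Z′₀** (p. 20 [20]), verbatim: *"We have δ½Lκd_{k+1}(Z′_i) instead of
δκd_k(Y), but the inequality (2.29) is valid for all k. The inequality (2.27) is used for the remaining exponential
factors. Assuming that 2(L+2)⁴O(1)ε₂ exp 5κ ≦ 1, we obtain for a fixed Z′₀, (2.37) |Σ_{𝐃,P,Z₀}(2.14)| ≦
exp(−(κ₁ − 1)(LM)⁻⁴|Z∖Z′₀|)[Π_i 2(L+2)⁴O(1)ε₂ exp(−(1 − 7δ)½Lκd_{k+1}(Z′_i))] exp O(1)α₅|Z|"* — if every member weight is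
at most `B13Step237.bracketF c A · exp(−(1 − 6δ)ℓκ·d_{k+1}(Z′))` (§B) then, by `B13Step237.familyStep_consts` (the
family/merging step with its honest restriction `B13Step237.R18sharp` = 2(L+2)⁴Aε₂·exp 5(1−7δ)ℓκ ≤ α₆ and surviving
bracket `bracketF/α₆`, cell GAPS C-B13-52), (2.27) and (2.29) at scale k + 1:
`famSum ≤ (bracketF c A/α₆)·exp(−(1 − 7δ)ℓκ·d_{k+1}(C))`. [cite: Balaban1988RG2Cluster, (2.37) p.20] -/
theorem famSum_le_237 (c : B13.Consts) (A ℓ : ℝ) (Fam : Finset (Finset ι)) (dι : ι → ℝ) (dC : ℝ) (G : ι → ℝ)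
    (hG0 : ∀ 𝒟 ∈ Fam, ∀ Z' ∈ 𝒟, 0 ≤ G Z')
    (hG : ∀ 𝒟 ∈ Fam, ∀ Z' ∈ 𝒟, G Z' ≤ B13Step237.bracketF c A * Real.exp (-((1 - 6 * c.δ) * ℓ * c.κ * dι Z')))
    (hF : 0 ≤ B13Step237.bracketF c A) (hα : 0 < c.α₆) (hr : 0 ≤ (1 - 7 * c.δ) * ℓ * c.κ)
    (h227 : ∀ D ∈ Fam, D.Nonempty ∧ dC + 5 ≤ ∑ i ∈ D, (dι i + 5))
    (h229 : ∑ D ∈ Fam, ∏ i ∈ D, (c.α₆ * Real.exp (-(c.δ * ℓ * c.κ * dι i))) ≤ 1)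
    (h18 : B13Step237.R18sharp c A ℓ) :
    famSum Fam G ≤ B13Step237.bracketF c A / c.α₆ * Real.exp (-((1 - 7 * c.δ) * ℓ * c.κ * dC)) :=
  le_trans (famSum_mono Fam hG0 hG) (B13Step237.familyStep_consts c A ℓ Fam dι dC hF hα hr h227 h229 h18)

end LevelC

/-! ## §D. The whole resummation pp. 17–20: (2.26) for every term (2.14) ⇒ Lemma 3's (2.38) -/

section Master

/-- **Lemma 3 assembled: (2.26) ⇒ (2.38)** (pp. 17–20 [17–20]).  P. 17, verbatim: *"To get a bound for H(Z) we have to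
perform the resummation of the terms (2.14) over 𝐃, P and Z₀. We do it in the following order. For a fixed Y₀ we sum over
all 𝐃 satisfying (2.2). Next, we sum over Y₀, P determining a fixed Z₀. Further, for a fixed Z′₀, we sum over all
possible Z₀ determining this fixed Z′₀. Finally we sum over all Z′₀ ⊂ Z. To bound H(Z) we use the estimate (2.26) for
terms of these sums, and we bound the sums using the factors on the right-hand side of (2.26)."*; p. 20: *"Thus we have
finished the estimate of the resummed terms (2.14). The sum defines the activity H(Z), and we have proved the following
lemma. Lemma 3. … |H(Z)| ≦ C₃ε₁ exp(−(1 − 8δ)½Lκd_{k+1}(Z)). (2.38)"*.  For the step carrier `B13.StepData` (general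
transfer factor ℓ; print ℓ = ½L): IF on the space of p. 15 the activity is bounded by the (2.26)-weights summed in the
printed order (over-counting allowed) — `hrep`: |H(Z)| ≤ e^{a₅ n(Z)} Σ_{Z′₀} e^{−(κ₁−1)|Z∖Z′₀|} Π_{components C of Z′₀}
`famSum` (families of 𝐃_{k+1}-domains covering C, `B13FamilySum.coveringFamilies`) of `compSum` (non-empty sets of
𝐃_k-domains with closure Z′) of `innerSum` (the sums over Y₀, P, 𝐃 of the factors `α₆ε₂ e^{−(1−3δ)κd_k(Y)}` and
`e^{−(a/2)|P|}`, a = γ₂ε₁²/g_k²) — THEN `B13.Bound238With S c ℓ`: |H(Z)| ≤ C₃ε₁ exp(−(1 − 8δ)ℓκ d_{k+1}(Z)), GIVEN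
the printed inputs as hypotheses in the tree's shapes: scale k — non-empty footprints, (2.29) `B13FamilySum.Ineq229`
at rate δκ, (2.27) for the components of Y₀ combined with (2.32) (constant c₃₂), G7 and the bond count `M4`, the upper
half of (2.30), the REPAIRED additive volume law `B13FamilySum.VolBound` with `e^{−a/20}c₁ ≤ δκ`, the transfer (2.36)
`B13.Ineq236With`, the anchored (1.26)-sum `B13FamilySum.Ineq126` at rate δκ with anchors of ≤ (L+2)⁴ cubes, and the
smallness clauses `B13.Consts.R15`, R16 (`c₃₂(1−4δ)κ ≤ a/20`, `4κ ≤ a/20`), R17, (2.31), `B13Step237.R18half`/`R18sharp`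
at A = K₁e^{e^{−a/20}c₁}; scale k + 1 — (2.27)/(2.29) `B13FamilySum.Ineq227`/`Ineq229` at rate δℓκ, the adapted (2.32)
(constant c₃₂′), R20, the absolute constant `a₅ + e^{−½(κ₁−1)} ≤ Aabs` (R21), the repaired volume law at scale k + 1
with `Aabs·c₁′ ≤ δℓκ`, and the absorption `(bracketF/α₆)·e^{Aabs c₁′} ≤ C₃ε₁` of the honest constants into the printed
O(1) of C₃ (cell GAPS C-B13-52 / D-b13.33, G-B13-P18-01, P21-01).  Chain: `innerSum_le_235` (§A) → `compSum_le_member`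
(§B) → `famSum_le_237` (§C) → `B13Bound238Assembly.norm_sum_le_238`.  Nothing geometric or analytic is asserted.
[cite: Balaban1988RG2Cluster, Lemma 3 (2.38) p.20] -/
theorem bound238With_of_226 (S : B13.StepData) (c : B13.Consts) (ℓ : ℝ)
    {Cube Bond α : Type*} [DecidableEq Cube] [DecidableEq Bond] [DecidableEq α]
    [DecidableEq S.Dk.Dom] [DecidableEq S.Dk1.Dom]
    (cubes : S.Dk.Dom → Finset Cube) (touch : Bond → Finset Cube) (avail : S.Dk.Dom → Finset Cube → Finset Bond)
    (cl : S.Dk.Dom → S.Dk1.Dom) (anchor : S.Dk1.Dom → Finset Cube)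
    (J : S.Dk1.Dom → Type*) [∀ Z, Fintype (J Z)] (I : ∀ Z, J Z → Type*) [∀ Z j, Fintype (I Z j)]
    [∀ Z j, Nonempty (I Z j)] (dI : ∀ Z j, I Z j → ℝ) (s : S.Dk1.Dom → Finset α) (w : ∀ Z, J Z → Finset α)
    (hw : ∀ Z, Function.Injective (w Z)) (hws : ∀ Z j, w Z j ⊆ s Z)
    (cubes1 : S.Dk1.Dom → Finset α) (cc : ∀ Z j, I Z j → Finset α)
    {a M4 c₃₂ c₁ K₁ c₃₂' a₅ Aabs c₁' : ℝ}
    (hrep : ∀ Z φ, φ ∈ S.sp2 Z → ‖S.H Z φ‖ ≤ Real.exp (a₅ * ((s Z).card : ℝ)) *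
      ∑ j : J Z, Real.exp (-((c.κ₁ - 1) * ((w Z j).card : ℝ))) *
        ∏ i : I Z j, famSum (B13FamilySum.coveringFamilies Finset.univ cubes1 (cc Z j i))
          (fun Z' => compSum (Finset.univ.filter fun Zc => cl Zc = Z')
            (fun Zc => innerSum Finset.univ cubes S.Dk.dj (cubes Zc) touch (avail Zc)
              (c.α₆ * c.eps2) ((1 - 3 * c.δ) * c.κ) a)))
    (hα₆ : 0 < c.α₆) (hε₀ : 0 ≤ c.eps2) (hδ : 0 ≤ c.δ) (hδ7 : 0 ≤ 1 - 7 * c.δ) (hκ : 0 ≤ c.κ) (hℓ : 0 ≤ ℓ)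
    (ha : 0 ≤ a) (hK₁ : 0 ≤ K₁)
    (hne : ∀ Y : S.Dk.Dom, (cubes Y).Nonempty)
    (hR15 : c.R15) (hR16 : c₃₂ * ((1 - 4 * c.δ) * c.κ) ≤ a / 20) (hR16' : 4 * c.κ ≤ a / 20)
    (hR17 : Real.exp (-(a / 20)) ≤ c.eps2) (h231 : M4 * Real.exp (-(a / 10)) ≤ a / 20)
    (htouch : ∀ b, (touch b).card ≤ 2)
    (havail : ∀ Zc Y₀, Y₀ ⊆ cubes Zc → ((avail Zc Y₀).card : ℝ) ≤ M4 * ((cubes Zc \ Y₀).card : ℝ))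
    (h229 : B13FamilySum.Ineq229 Finset.univ cubes S.Dk.dj c.α₆ (c.δ * c.κ))
    (h2732 : ∀ Zc Y₀, Y₀ ⊆ cubes Zc → ∀ D ∈ B13FamilySum.coveringFamilies Finset.univ cubes Y₀, D.Nonempty →
      S.Dk.dj Zc + 5 ≤ ∑ Y ∈ D, (S.Dk.dj Y + 5) + c₃₂ * ((cubes Zc \ Y₀).card : ℝ))
    (h230 : ∀ Zc, S.Dk.dj Zc + 1 ≤ ((cubes Zc).card : ℝ))
    (hvol : B13FamilySum.VolBound Finset.univ cubes S.Dk.dj c₁) (habsk : Real.exp (-(a / 20)) * c₁ ≤ c.δ * c.κ)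
    (h236 : B13.Ineq236With S.Dk S.Dk1 cl ℓ)
    (hanch : ∀ Zc, ∃ q ∈ anchor (cl Zc), q ∈ cubes Zc)
    (hLfac : ∀ Z', ((anchor Z').card : ℝ) ≤ ((c.L : ℝ) + 2) ^ 4)
    (h126 : B13FamilySum.Ineq126 Finset.univ cubes S.Dk.dj (c.δ * c.κ) K₁)
    (h18half : B13Step237.R18half c (K₁ * Real.exp (Real.exp (-(a / 20)) * c₁)))
    (h18 : B13Step237.R18sharp c (K₁ * Real.exp (Real.exp (-(a / 20)) * c₁)) ℓ)
    (hcc : ∀ Z j i, (cc Z j i).Nonempty)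
    (h227' : ∀ Z j i, B13FamilySum.Ineq227 Finset.univ cubes1 S.Dk1.dj (cc Z j i) (dI Z j i) 5)
    (h229' : B13FamilySum.Ineq229 Finset.univ cubes1 S.Dk1.dj c.α₆ (c.δ * ℓ * c.κ))
    (h232 : ∀ Z j, S.Dk1.dj Z ≤ ∑ i, dI Z j i + c₃₂' * ((w Z j).card : ℝ))
    (hR20 : c₃₂' * ((1 - 7 * c.δ) * ℓ * c.κ) ≤ (c.κ₁ - 1) / 2)
    (ha₅ : 0 ≤ a₅) (habs : a₅ + Real.exp (-((c.κ₁ - 1) / 2)) ≤ Aabs)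
    (hvol1 : ∀ Z, ((s Z).card : ℝ) ≤ c₁' * (1 + S.Dk1.dj Z)) (hAc : Aabs * c₁' ≤ c.δ * ℓ * c.κ)
    (hC3 : B13Step237.bracketF c (K₁ * Real.exp (Real.exp (-(a / 20)) * c₁)) / c.α₆ * Real.exp (Aabs * c₁') ≤
      c.C3act * c.ε₁) :
    B13.Bound238With S c ℓ := by
  -- abbreviations
  set b : ℝ := Real.exp (-(a / 20)) with hb
  set A : ℝ := K₁ * Real.exp (b * c₁) with hA
  set F : ℝ := B13Step237.bracketF c A / c.α₆ with hF
  set inner : S.Dk.Dom → ℝ := fun Zc => innerSum Finset.univ cubes S.Dk.dj (cubes Zc) touch (avail Zc)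
    (c.α₆ * c.eps2) ((1 - 3 * c.δ) * c.κ) a with hinner
  have hδ4 : 0 ≤ 1 - 4 * c.δ := by linarith
  have hδ6 : 0 ≤ (1 - 6 * c.δ) * c.κ := mul_nonneg (by linarith) hκ
  -- Step 1 (§A): every 𝐃_k-domain in the role of a component Z_i of Z₀
  have h1 : ∀ Zc, inner Zc ≤ c.eps2 * Real.exp (b * c₁) * Real.exp (-((1 - 5 * c.δ) * c.κ * S.Dk.dj Zc)) := by
    intro Zc
    have hN1 : (1 : ℝ) ≤ ((cubes Zc).card : ℝ) := by linarith [h230 Zc, S.Dk.dj_nonneg Zc]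
    simp only [hinner]
    exact innerSum_le_235 Finset.univ cubes S.Dk.dj (cubes Zc) (S.Dk.dj Zc) touch (avail Zc) rfl
      (fun Y _ => hne Y) hα₆.le hε₀ hδ hδ4 hκ ha (S.Dk.dj_nonneg Zc) hR15 hR16 hR16' hR17 h231 htouch
      (fun Y₀ hY₀ => havail Zc Y₀ hY₀) (fun Y₀ _ => h229 Y₀) (fun Y₀ hY₀ => h2732 Zc Y₀ hY₀) hN1 (h230 Zc)
      (hvol Zc (Finset.mem_univ _)) habsk
  have h1nn : ∀ Zc, 0 ≤ inner Zc := by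
    intro Zc
    simp only [hinner]
    exact innerSum_nonneg _ _ _ _ _ _ (mul_nonneg hα₆.le hε₀)
  -- Step 2 (§B): the component sum at a fixed closure Z′
  have hent : ∀ Z', ∑ Zc ∈ Finset.univ.filter (fun Zc => cl Zc = Z'), Real.exp (-(c.δ * c.κ * S.Dk.dj Zc)) ≤
      ((c.L : ℝ) + 2) ^ 4 * K₁ := by
    intro Z'
    have h := anchored_sum_le (Finset.univ.filter fun Zc => cl Zc = Z') Finset.univ (Finset.filter_subset _ _)
      cubes (anchor Z') (fun Zc => Real.exp (-(c.δ * c.κ * S.Dk.dj Zc))) (fun Zc _ => (Real.exp_pos _).le)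
      (fun Zc hZc => by
        have hcl : cl Zc = Z' := (Finset.mem_filter.mp hZc).2
        rw [← hcl]
        exact hanch Zc)
      (fun q _ => h126 q)
    exact le_trans h (mul_le_mul_of_nonneg_right (hLfac Z') hK₁)
  have h2 : ∀ Z', compSum (Finset.univ.filter fun Zc => cl Zc = Z') inner ≤
      B13Step237.bracketF c A * Real.exp (-((1 - 6 * c.δ) * ℓ * c.κ * S.Dk1.dj Z')) := by
    intro Z'
    have h := compSum_le_member (Finset.univ.filter fun Zc => cl Zc = Z') inner S.Dk.dj
      (ε := c.eps2 * Real.exp (b * c₁)) (t := c.δ * c.κ) (u := (1 - 6 * c.δ) * c.κ) (ℓ := ℓ)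
      (dZ' := S.Dk1.dj Z') (E := ((c.L : ℝ) + 2) ^ 4 * K₁)
      (by positivity) hδ6 hℓ (S.Dk1.dj_nonneg Z') (fun Zc _ => h1nn Zc)
      (fun Zc _ => by
        have e : c.δ * c.κ + (1 - 6 * c.δ) * c.κ = (1 - 5 * c.δ) * c.κ := by ring
        rw [e]
        exact h1 Zc)
      (fun Zc hZc => by
        have hcl : cl Zc = Z' := (Finset.mem_filter.mp hZc).2
        rw [← hcl]
        exact h236 Zc)
      (hent Z')
      (by
        have e1 : ((c.L : ℝ) + 2) ^ 4 * K₁ * (c.eps2 * Real.exp (b * c₁)) = B13Step237.memberF c A := by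
          simp only [B13Step237.memberF, hA]; ring
        rw [e1]
        exact h18half)
    have e2 : 2 * (((c.L : ℝ) + 2) ^ 4 * K₁ * (c.eps2 * Real.exp (b * c₁))) = B13Step237.bracketF c A := by
      simp only [B13Step237.bracketF, B13Step237.memberF, hA]; ring
    have e3 : (1 - 6 * c.δ) * c.κ * ℓ * S.Dk1.dj Z' = (1 - 6 * c.δ) * ℓ * c.κ * S.Dk1.dj Z' := by ring
    rw [e2, e3] at h
    exact h
  -- Step 3 (§C): the family sum per component of Z′₀
  have hbF : 0 ≤ B13Step237.bracketF c A := by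
    simp only [B13Step237.bracketF, B13Step237.memberF, hA]; positivity
  have hr7 : 0 ≤ (1 - 7 * c.δ) * ℓ * c.κ := by positivity
  have h3 : ∀ Z j i, famSum (B13FamilySum.coveringFamilies Finset.univ cubes1 (cc Z j i))
      (fun Z' => compSum (Finset.univ.filter fun Zc => cl Zc = Z') inner) ≤
      F * Real.exp (-((1 - 7 * c.δ) * ℓ * c.κ * dI Z j i)) := by
    intro Z j i
    refine famSum_le_237 c A ℓ _ S.Dk1.dj (dI Z j i) _
      (fun 𝒟 _ Z' _ => compSum_nonneg _ _ fun Zc _ => h1nn Zc) (fun 𝒟 _ Z' _ => h2 Z') hbF hα₆ hr7 ?_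
      (h229' (cc Z j i)) h18
    intro D hD
    exact ⟨nonempty_of_mem_coveringFamilies (hcc Z j i) hD, h227' Z j i D hD⟩
  have h3nn : ∀ Z j i, 0 ≤ famSum (B13FamilySum.coveringFamilies Finset.univ cubes1 (cc Z j i))
      (fun Z' => compSum (Finset.univ.filter fun Zc => cl Zc = Z') inner) :=
    fun Z j i => famSum_nonneg _ fun 𝒟 _ Z' _ => compSum_nonneg _ _ fun Zc _ => h1nn Zc
  -- Step 4 (`B13Bound238Assembly`): the sum over Z′₀ ⊂ Z
  have hF0 : 0 ≤ F := by rw [hF]; positivity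
  have hF1 : F ≤ 1 := by
    rw [hF, div_le_one hα₆]
    have h18' : B13Step237.bracketF c A * Real.exp (5 * ((1 - 7 * c.δ) * ℓ * c.κ)) ≤ c.α₆ := h18
    have hexp : 1 ≤ Real.exp (5 * ((1 - 7 * c.δ) * ℓ * c.κ)) := Real.one_le_exp (by positivity)
    exact le_trans (le_mul_of_one_le_right hbF hexp) h18'
  intro Z φ hφ
  set t : J Z → ℝ := fun j => Real.exp (-((c.κ₁ - 1) * ((w Z j).card : ℝ))) *
    (∏ i : I Z j, famSum (B13FamilySum.coveringFamilies Finset.univ cubes1 (cc Z j i))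
      (fun Z' => compSum (Finset.univ.filter fun Zc => cl Zc = Z') inner)) *
    Real.exp (a₅ * ((s Z).card : ℝ)) with ht
  have htnn : ∀ j, 0 ≤ t j := by
    intro j
    simp only [ht]
    exact mul_nonneg (mul_nonneg (Real.exp_nonneg _) (Finset.prod_nonneg fun i _ => h3nn Z j i))
      (Real.exp_nonneg _)
  have h237 : ∀ j, ‖((t j : ℝ) : ℂ)‖ ≤ Real.exp (-((c.κ₁ - 1) * ((w Z j).card : ℝ))) *
      (∏ i : I Z j, (F * Real.exp (-((1 - 7 * c.δ) * ℓ * c.κ * dI Z j i)))) *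
        Real.exp (a₅ * ((s Z).card : ℝ)) := by
    intro j
    rw [Complex.norm_real, Real.norm_of_nonneg (htnn j)]
    simp only [ht]
    refine mul_le_mul_of_nonneg_right (mul_le_mul_of_nonneg_left ?_ (Real.exp_nonneg _)) (Real.exp_nonneg _)
    exact Finset.prod_le_prod (fun i _ => h3nn Z j i) fun i _ => h3 Z j i
  have hmain := B13Bound238Assembly.norm_sum_le_238 (I Z) (dI Z) (s Z) (w Z) (hw Z) (hws Z)
    (fun j => ((t j : ℝ) : ℂ)) (dlk := c.δ * ℓ * c.κ) hF0 hF1 hr7 (S.Dk1.dj_nonneg Z) (h232 Z) hR20 h237 ha₅ habs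
    (hvol1 Z) hAc
  have hsum : ‖S.H Z φ‖ ≤ ‖∑ j, ((t j : ℝ) : ℂ)‖ := by
    have hre : ‖∑ j, ((t j : ℝ) : ℂ)‖ = ∑ j, t j := by
      rw [← Complex.ofReal_sum, Complex.norm_real, Real.norm_of_nonneg (Finset.sum_nonneg fun j _ => htnn j)]
    rw [hre]
    refine le_trans (hrep Z φ hφ) (le_of_eq ?_)
    rw [Finset.mul_sum]
    refine Finset.sum_congr rfl fun j _ => ?_
    simp only [ht]
    ring
  have hrate : (1 - 7 * c.δ) * ℓ * c.κ - c.δ * ℓ * c.κ = (1 - 8 * c.δ) * ℓ * c.κ := by ring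
  rw [hrate] at hmain
  calc ‖S.H Z φ‖ ≤ ‖∑ j, ((t j : ℝ) : ℂ)‖ := hsum
    _ ≤ F * Real.exp (Aabs * c₁') * Real.exp (-((1 - 8 * c.δ) * ℓ * c.κ * S.Dk1.dj Z)) := hmain
    _ ≤ c.C3act * c.ε₁ * Real.exp (-((1 - 8 * c.δ) * ℓ * c.κ * S.Dk1.dj Z)) :=
        mul_le_mul_of_nonneg_right hC3 (Real.exp_nonneg _)

end Master

/-! ## §E. Edges to the statement rows: Lemma 3 (`B13.Lemma3With`, `B13.Lemma3Printed`) and the combined form of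
(2.27) + (2.32) from the two printed inequalities -/

section Edges

/-- The statement row: `B13.Lemma3With S c ℓ` (:= `S.Restr → Bound238With S c ℓ`) from the assembled bound — the
restrictions having been consumed as the explicit hypotheses of `bound238With_of_226`. [cite: Balaban1988RG2Cluster, Lemma 3 p.20] -/
theorem lemma3With_of_bound238With (S : B13.StepData) (c : B13.Consts) (ℓ : ℝ) (h : B13.Bound238With S c ℓ) :
    B13.Lemma3With S c ℓ := fun _ => h

/-- At the printed transfer factor ℓ = ½L the assembled bound is Lemma 3 AS PRINTED, `B13.Lemma3Printed S c`
(`B13.bound238With_half`). [cite: Balaban1988RG2Cluster, Lemma 3 (2.38) p.20] -/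
theorem lemma3Printed_of_bound238With_half (S : B13.StepData) (c : B13.Consts)
    (h : B13.Bound238With S c ((c.L : ℝ) / 2)) : B13.Lemma3Printed S c :=
  fun _ => (B13.bound238With_half S c).1 h

variable {Cube Dom : Type*} [DecidableEq Cube]

/-- The COMBINED input of §A from the two printed inequalities (p. 18 [18]): (2.27) *"Σ_{Y∈𝐃}(d_k(Y) + 5) ≧ d_k(Y₀) + 5"*
for each connected component Y_i of Y₀ (`B13FamilySum.Ineq227` per component, the sub-family 𝐃_i = the members inside
Y_i — p. 17: *"this decomposition induces the decomposition of the families 𝐃, 𝐃 = ∪_i 𝐃_i, 𝐃_i satisfy ∪_{Y∈𝐃_i} Y =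
Y_i"*) and (2.32) *"Σ_i d_k(Y_i) + 4M⁻⁴|Z₀∖Y₀| ≧ d_k(Z₀)"* in the generic-constant form `dZ ≤ Σ_i d_k(Y_i) + c₃₂N′`:
for every covering family 𝐃 of Y₀, `dZ + 5 ≤ Σ_{Y∈𝐃}(d_k(Y) + 5) + c₃₂N′`.  Inputs: the components `parts` are
non-empty as a family, pairwise disjoint, and every catalogue domain inside Y₀ lies inside one of them (connectedness);
footprints non-empty; lengths ≥ 0. [cite: Balaban1988RG2Cluster, (2.27) p.18 and (2.32) p.18] -/
theorem combined_of_227_232 (S : Finset Dom) (cubes : Dom → Finset Cube) (d : Dom → ℝ) (Y₀ : Finset Cube)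
    (parts : Finset (Finset Cube)) (dpart : Finset Cube → ℝ) {dZ c₃₂ N' : ℝ}
    (hne : ∀ Y ∈ S, (cubes Y).Nonempty) (hd : ∀ Y ∈ S, 0 ≤ d Y) (hparts : parts.Nonempty)
    (hpsub : ∀ p ∈ parts, p ⊆ Y₀)
    (hdisj : ∀ p ∈ parts, ∀ q ∈ parts, p ≠ q → Disjoint p q)
    (hcomp : ∀ Y ∈ S, cubes Y ⊆ Y₀ → ∃ p ∈ parts, cubes Y ⊆ p)
    (h227 : ∀ p ∈ parts, B13FamilySum.Ineq227 S cubes d p (dpart p) 5)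
    (h232 : dZ ≤ ∑ p ∈ parts, dpart p + c₃₂ * N') :
    ∀ D ∈ B13FamilySum.coveringFamilies S cubes Y₀, dZ + 5 ≤ ∑ Y ∈ D, (d Y + 5) + c₃₂ * N' := by
  classical
  intro D hD
  obtain ⟨hDS, hU⟩ := B13FamilySum.mem_coveringFamilies.mp hD
  -- the sub-families 𝐃_i
  set Dp : Finset Cube → Finset Dom := fun p => D.filter fun Y => cubes Y ⊆ p with hDp
  have hmemY₀ : ∀ Y ∈ D, cubes Y ⊆ Y₀ := by
    intro Y hY
    rw [← hU]
    exact Finset.subset_biUnion_of_mem cubes hY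
  -- each 𝐃_i is a covering family of Y_i
  have hDp_cov : ∀ p ∈ parts, Dp p ∈ B13FamilySum.coveringFamilies S cubes p := by
    intro p hp
    refine B13FamilySum.mem_coveringFamilies.mpr ⟨fun Y hY => hDS (Finset.mem_filter.mp hY).1, ?_⟩
    refine Finset.Subset.antisymm ?_ ?_
    · intro x hx
      obtain ⟨Y, hY, hxY⟩ := Finset.mem_biUnion.mp hx
      exact (Finset.mem_filter.mp hY).2 hxY
    · intro x hx
      have hxY₀ : x ∈ Y₀ := hpsub p hp hx
      rw [← hU] at hxY₀
      obtain ⟨Y, hY, hxY⟩ := Finset.mem_biUnion.mp hxY₀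
      obtain ⟨q, hq, hYq⟩ := hcomp Y (hDS hY) (hmemY₀ Y hY)
      have hpq : p = q := by
        by_contra hne'
        exact Finset.disjoint_left.mp (hdisj p hp q hq hne') hx (hYq hxY)
      subst hpq
      exact Finset.mem_biUnion.mpr ⟨Y, Finset.mem_filter.mpr ⟨hY, hYq⟩, hxY⟩
  -- the 𝐃_i are pairwise disjoint sub-families of 𝐃
  have hDp_disj : (parts : Set (Finset Cube)).PairwiseDisjoint Dp := by
    intro p hp q hq hpq
    rw [Function.onFun, Finset.disjoint_left]
    intro Y hYp hYq
    have hYp' := Finset.mem_filter.mp hYp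
    have hYq' := Finset.mem_filter.mp hYq
    obtain ⟨x, hx⟩ := hne Y (hDS hYp'.1)
    exact Finset.disjoint_left.mp (hdisj p hp q hq hpq) (hYp'.2 hx) (hYq'.2 hx)
  have hsub : parts.biUnion Dp ⊆ D := by
    intro Y hY
    obtain ⟨p, -, hYp⟩ := Finset.mem_biUnion.mp hY
    exact (Finset.mem_filter.mp hYp).1
  have hnn : ∀ Y ∈ D, 0 ≤ d Y + 5 := fun Y hY => by linarith [hd Y (hDS hY)]
  have hcard : (1 : ℝ) ≤ (parts.card : ℝ) := by exact_mod_cast hparts.card_pos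
  calc dZ + 5 ≤ ∑ p ∈ parts, dpart p + c₃₂ * N' + 5 := by linarith
    _ ≤ ∑ p ∈ parts, (dpart p + 5) + c₃₂ * N' := by
        rw [Finset.sum_add_distrib, Finset.sum_const, nsmul_eq_mul]
        nlinarith
    _ ≤ ∑ p ∈ parts, ∑ Y ∈ Dp p, (d Y + 5) + c₃₂ * N' := by
        gcongr with p hp
        exact h227 p hp (Dp p) (hDp_cov p hp)
    _ = ∑ Y ∈ parts.biUnion Dp, (d Y + 5) + c₃₂ * N' := by rw [Finset.sum_biUnion hDp_disj]
    _ ≤ ∑ Y ∈ D, (d Y + 5) + c₃₂ * N' := by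
        linarith [Finset.sum_le_sum_of_subset_of_nonneg hsub fun Y hY _ => hnn Y hY]

end Edges

end Literature.MathematicalPhysics.QuantumFieldTheory.Balaban1983to89.B13Lemma3Assembly
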